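import Summits.CriticalPhenomena.CardyFormulaZ2.Theorems.CardyBoundaryCoulombGasRectilinearCardyStubKernelWindowLawPart2
import Summits.CriticalPhenomena.CardyFormulaZ2.Theorems.CardyBoundaryCoulombGasRectilinearCardyStubKernelWindowLawPart3
import HarnessLib

/-!
# Stub `stub_kernelWindowLaw` of line `excursion-kernel-covariance`, part 5: the renormalised window
# mass is a Riemann sum (crux `RectilinearCardy`, stmt-CriticalPhenomena-5660, route `CardyBoundaryCoulombGas`)

For a window `[s, s']` strictly inside a parameter range `[σ, σ']` carrying a window frame
(part 1: orientation `o`, height `h`, radius `r`; near every window point `Ω̄ = {nrmC o ≥ h}`), the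
set `W_δ = rowTail R δ s ∖ rowTail R δ s'` of boundary-row vertices attributed to `∂Ω[s, d]` but not
to `∂Ω[s', d]` is, for small `δ`, in bijection with the lattice points `δk` of the chord
`[T(s), T(s')]` of the side (`T = tngC o ∘ ∂Ω`, up to the two end points) via the tangential
coordinate `k = tng o v`; the foot of `v` is the window point `T⁻¹(δk)`, at distance `< δ`
(`kwl_sdiff_vertex`, `kwl_mem_sdiff_of_foot`, from part 2).

Consequently (`kwl_window_sum_tendsto`), if a normaliser `N` satisfies the UNIFORM POINT
ASYMPTOTICS of the cube-root weight on `[σ, σ']` with some continuum kernel `Φ` (the hypothesis of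
the stub, produced by `stub_kernelPointAsymptotics`), then
`(Σ_{v ∈ W_δ} rowWeight R δ v) / N δ → ∫_{T s ⊓ T s'}^{T s ⊔ T s'} Φ(x e + h ν) dx` as `δ → 0⁺`
(the Riemann-sum lemma of part 3).

All [folklore].
-/

noncomputable section

open Set Filter Topology Metric
open Literature.Probability.RandomPlanarGeometry
open Literature.Probability.LatticeModels (Site meshPoint zdGraph Orient)

namespace Summit.CriticalPhenomena.CardyFormulaZ2.Cruxes.RectilinearCardy.ExcursionKernelCovariance

/-! ### The vertices where the two tails differ -/

/-- **Structure of `W_δ = rowTail s ∖ rowTail s'`.** In a window frame on `[σ, σ']` with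
`σ < s ≤ s' < σ'`, for `0 < δ` with `4δ ≤ r` and `2δ < d₀` (`d₀` the separation radius of
`kwl_exists_param_sep`): every `v ∈ W_δ` lies on the row `nrm o v = ⌈h/δ⌉`, and its foot on the side
is a window point `∂Ω(u)` with `u ∈ [s, s')`, at distance `< δ` from `δv`. [folklore] -/
theorem kwl_sdiff_vertex (R : ConformalRectangle) {o : Orient} {h r σ σ' s s' : ℝ}
    (h1 : R.mark 1 < σ) (hσs : σ < s) (hss' : s ≤ s') (hs'σ' : s' < σ') (h3 : σ' < R.mark 3)
    (hcl : ∀ t ∈ Icc σ σ', ∀ z, dist z (R.boundary t) < r →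
      (z ∈ closure R.carrier ↔ h ≤ Orient.nrmC o z))
    (hop : ∀ t ∈ Icc σ σ', ∀ z, dist z (R.boundary t) < r → (z ∈ R.carrier ↔ h < Orient.nrmC o z))
    {d₀ : ℝ} (hd₀ : ∀ z ∈ frontier R.carrier, ∀ τ ∈ Icc s s', dist z (R.boundary τ) < d₀ →
      ∃ u ∈ Ioo σ σ', R.boundary u = z)
    {δ : ℝ} (hδ : 0 < δ) (hδr : 4 * δ ≤ r) (hδd : 2 * δ < d₀)
    {v : Site 2} (hv : v ∈ rowTail R δ s \ rowTail R δ s') :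
    Orient.nrm o v = ⌈h / δ⌉ ∧ ∃ u ∈ Ico s s',
      R.boundary u = (((δ * (Orient.tng o v : ℝ) : ℝ)) : ℂ) * Orient.e o + ((h : ℝ) : ℂ) * Orient.ν o ∧
      dist (meshPoint δ v) (R.boundary u) < δ := by
  rw [Finset.mem_sdiff] at hv
  obtain ⟨hvs, hvs'⟩ := hv
  obtain ⟨hvrow, hin⟩ := (mem_rowTail_iff R).1 hvs
  have hout : ¬ infDist (meshPoint δ v) (tailArc R s') ≤
      infDist (meshPoint δ v) (frontier R.carrier \ tailArc R s') :=
    fun h' => hvs' ((mem_rowTail_iff R).2 ⟨hvrow, h'⟩)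
  set p : ℂ := meshPoint δ v with hp
  -- `p` is within `δ` of the window
  have hB := kwl_infDist_window_le R (h1.le.trans hσs.le) hss' (hs'σ'.le.trans h3.le) hin hout
  have hF := kwl_infDist_frontier_le_of_mem_boundaryRow R hδ hvrow
  obtain ⟨z, ⟨τ, hτ, rfl⟩, hzd⟩ := (isCompact_Icc.image R.continuous_boundary).exists_infDist_eq_dist
    ⟨R.boundary s, s, ⟨le_rfl, hss'⟩, rfl⟩ p
  have hpτ : dist p (R.boundary τ) ≤ δ := by rw [← hzd]; exact hB.trans hF
  have hτ' : τ ∈ Icc σ σ' := ⟨hσs.le.trans hτ.1, hτ.2.trans hs'σ'.le⟩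
  -- hence on the row
  have hvn : Orient.nrm o v = ⌈h / δ⌉ :=
    kwl_nrm_eq_of_mem_boundaryRow R (hcl τ hτ') hδ hvrow (by linarith)
  -- the foot is a frontier point near `∂Ω(τ)`, hence a window point `∂Ω(u)`, `u ∈ (σ, σ')`
  set x : ℂ := (((δ * (Orient.tng o v : ℝ) : ℝ)) : ℂ) * Orient.e o + ((h : ℝ) : ℂ) * Orient.ν o with hx
  have htp : Orient.tngC o p = δ * (Orient.tng o v : ℝ) := Orient.tngC_meshPoint o δ v
  have hnp : Orient.nrmC o p = δ * (⌈h / δ⌉ : ℝ) := by rw [hp, Orient.nrmC_meshPoint, hvn]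
  obtain ⟨hm1, hm2⟩ := kwl_ceil_bounds (h := h) hδ
  have hpx : dist p x = δ * (⌈h / δ⌉ : ℝ) - h := by
    rw [hx, ← htp, kwl_dist_foot, hnp, abs_of_nonneg (by linarith)]
  have hxτ : dist x (R.boundary τ) < 2 * δ := by
    have := dist_triangle x p (R.boundary τ)
    rw [dist_comm x p] at this
    linarith
  have hxn : Orient.nrmC o x = h := Orient.nrmC_combo o _ _
  have hxf : x ∈ frontier R.carrier :=
    (kwl_mem_frontier_iff_nrmC R (hcl τ hτ') (hop τ hτ') (by linarith)).2 hxn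
  obtain ⟨u, hu, hux⟩ := hd₀ x hxf τ hτ (by linarith)
  have hu' : u ∈ Icc σ σ' := ⟨hu.1.le, hu.2.le⟩
  have hsI : s ∈ Icc σ σ' := ⟨hσs.le, hss'.trans hs'σ'.le⟩
  have hs'I : s' ∈ Icc σ σ' := ⟨hσs.le.trans hss', hs'σ'.le⟩
  have hsu : s ≤ u :=
    (kwl_mem_rowTail_iff R h1 h3 hcl hop hδ (by linarith) hvrow hvn hu' hux hsI).1 hvs
  have hus' : u < s' := by
    by_contra hle
    rw [not_lt] at hle
    exact hvs' ((kwl_mem_rowTail_iff R h1 h3 hcl hop hδ (by linarith) hvrow hvn hu' hux hs'I).2 hle)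
  refine ⟨hvn, u, ⟨hsu, hus'⟩, hux, ?_⟩
  rw [hux, hpx]
  linarith

/-- **Converse: row vertices with foot in the window are in `W_δ`.** If `nrm o v = ⌈h/δ⌉` and the foot
of `v` is `∂Ω(u)` with `u ∈ [s, s')` (`σ ≤ s`, `s' ≤ σ'`, `2δ ≤ r`), then
`v ∈ rowTail R δ s ∖ rowTail R δ s'`. [folklore] -/
theorem kwl_mem_sdiff_of_foot (R : ConformalRectangle) {o : Orient} {h r σ σ' s s' : ℝ}
    (h1 : R.mark 1 < σ) (hσs : σ ≤ s) (hs'σ' : s' ≤ σ') (h3 : σ' < R.mark 3)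
    (hcl : ∀ t ∈ Icc σ σ', ∀ z, dist z (R.boundary t) < r →
      (z ∈ closure R.carrier ↔ h ≤ Orient.nrmC o z))
    (hop : ∀ t ∈ Icc σ σ', ∀ z, dist z (R.boundary t) < r → (z ∈ R.carrier ↔ h < Orient.nrmC o z))
    {δ : ℝ} (hδ : 0 < δ) (hδr : 2 * δ ≤ r) {v : Site 2} (hvn : Orient.nrm o v = ⌈h / δ⌉) {u : ℝ}
    (hu : u ∈ Ico s s')
    (hux : R.boundary u = (((δ * (Orient.tng o v : ℝ) : ℝ)) : ℂ) * Orient.e o + ((h : ℝ) : ℂ) * Orient.ν o) :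
    v ∈ rowTail R δ s \ rowTail R δ s' := by
  have hu' : u ∈ Icc σ σ' := ⟨hσs.trans hu.1, hu.2.le.trans hs'σ'⟩
  obtain ⟨hm1, hm2⟩ := kwl_ceil_bounds (h := h) hδ
  have hpu : dist (meshPoint δ v) (R.boundary u) = δ * (⌈h / δ⌉ : ℝ) - h := by
    rw [hux, ← Orient.tngC_meshPoint o δ v, kwl_dist_foot, Orient.nrmC_meshPoint, hvn,
      abs_of_nonneg (by linarith)]
  have hvrow : v ∈ boundaryRow R δ :=
    kwl_mem_boundaryRow_of_nrm R (hcl u hu') hδ hvn (by rw [hpu]; linarith)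
  have hss' : s ≤ s' := hu.1.trans hu.2.le
  rw [Finset.mem_sdiff]
  refine ⟨(kwl_mem_rowTail_iff R h1 h3 hcl hop hδ hδr hvrow hvn hu' hux ⟨hσs, hss'.trans hs'σ'⟩).2 hu.1,
    fun h' => not_le.2 hu.2 ?_⟩
  exact (kwl_mem_rowTail_iff R h1 h3 hcl hop hδ hδr hvrow hvn hu' hux ⟨hσs.trans hss', hs'σ'⟩).1 h'

/-- The tangential coordinate is injective on `W_δ`-type sets of row vertices: a vertex is determined
by its frame coordinates. [folklore] -/
theorem kwl_eq_of_tng_eq_of_nrm_eq {o : Orient} {v v' : Site 2} (ht : Orient.tng o v = Orient.tng o v')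
    (hn : Orient.nrm o v = Orient.nrm o v') : v = v' := by
  apply (Orient.frame o).injective
  ext i
  fin_cases i
  · show Orient.frame o v 0 = Orient.frame o v' 0
    rw [Orient.frame_apply_zero, Orient.frame_apply_zero, ht]
  · show Orient.frame o v 1 = Orient.frame o v' 1
    rw [Orient.frame_apply_one, Orient.frame_apply_one, hn]

/-- A finite set of integers inside the closed lattice interval `{k : α ≤ δk ≤ β}` has
`δ · card ≤ β - α + δ`. [folklore] -/
theorem kwl_card_mul_le {K : Finset ℤ} {α β δ : ℝ} (hδ : 0 < δ) (hαβ : α ≤ β)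
    (hK : ∀ k ∈ K, α ≤ δ * k ∧ δ * k ≤ β) : (K.card : ℝ) * δ ≤ β - α + δ := by
  have hsub : K ⊆ Finset.Icc ⌈α / δ⌉ ⌊β / δ⌋ := fun k hk => by
    obtain ⟨h1, h2⟩ := hK k hk
    rw [Finset.mem_Icc]
    constructor
    · exact Int.ceil_le.2 (by rwa [div_le_iff₀ hδ, mul_comm])
    · exact Int.le_floor.2 (by rwa [le_div_iff₀ hδ, mul_comm])
  have hcard := Finset.card_le_card hsub
  rw [Int.card_Icc] at hcard
  have hb : (⌊β / δ⌋ : ℝ) * δ ≤ β := by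
    have := Int.floor_le (β / δ); rwa [le_div_iff₀ hδ] at this
  have ha : α ≤ (⌈α / δ⌉ : ℝ) * δ := by
    have := Int.le_ceil (α / δ); rwa [div_le_iff₀ hδ] at this
  rcases le_or_gt (⌊β / δ⌋ + 1 - ⌈α / δ⌉) 0 with hle | hpos
  · have h0 : K.card = 0 := by have := Int.toNat_of_nonpos hle; omega
    rw [h0]; push_cast; linarith
  · have h2 : ((K.card : ℕ) : ℤ) ≤ ⌊β / δ⌋ + 1 - ⌈α / δ⌉ := by
      have := Int.toNat_of_nonneg hpos.le; omega
    have h3 : (K.card : ℝ) ≤ (⌊β / δ⌋ : ℝ) + 1 - (⌈α / δ⌉ : ℝ) := by exact_mod_cast h2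
    nlinarith

/-! ### The renormalised window mass is a Riemann sum -/

/-- **The renormalised window mass converges to the side integral of the continuum kernel.** In a
window frame on `[σ, σ']` (orientation `o`, height `h`, radius `r`), for a window
`σ < s < s' < σ'` and a normaliser `N` satisfying the uniform point asymptotics of the cube-root
weight on `[σ, σ']` with a continuum kernel `Φ` whose restriction to the chord of the window is
continuous: `(Σ_{v ∈ rowTail s ∖ rowTail s'} rowWeight R δ v) / N δ →
∫_{T s ⊓ T s'}^{T s ⊔ T s'} Φ(x e + h ν) dx`, `T = tngC o ∘ ∂Ω`. Proof: by `kwl_sdiff_vertex` /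
`kwl_mem_sdiff_of_foot` the tangential coordinates of `W_δ` form a set of integers sandwiched between
the open and the closed lattice chord, each weight is `δ N δ (Φ(foot) + O(ε))` with the foot the
lattice point `δ · tng`, and `kwl_riemann_sum` applies; `δ · #W_δ ≤ |chord| + δ`. [folklore] -/
theorem kwl_window_sum_tendsto (R : ConformalRectangle) {o : Orient} {h r σ σ' s s' : ℝ}
    (h1 : R.mark 1 < σ) (hσs : σ < s) (hss' : s < s') (hs'σ' : s' < σ') (h3 : σ' < R.mark 3)
    (hr : 0 < r) (hh : ∀ t ∈ Icc σ σ', Orient.nrmC o (R.boundary t) = h)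
    (hcl : ∀ t ∈ Icc σ σ', ∀ z, dist z (R.boundary t) < r →
      (z ∈ closure R.carrier ↔ h ≤ Orient.nrmC o z))
    (hop : ∀ t ∈ Icc σ σ', ∀ z, dist z (R.boundary t) < r → (z ∈ R.carrier ↔ h < Orient.nrmC o z))
    {N : ℝ → ℝ} {Φ : ℂ → ℝ}
    (hN : ∀ ε : ℝ, 0 < ε → ∀ᶠ δ in 𝓝[>] (0 : ℝ), ∀ v ∈ boundaryRow R δ, ∀ τ ∈ Icc σ σ',
      dist (meshPoint δ v) (R.boundary τ) ≤ 4 * δ → |rowWeight R δ v / (δ * N δ) - Φ (R.boundary τ)| ≤ ε)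
    (hΦc : ContinuousOn (fun x : ℝ => Φ (((x : ℝ) : ℂ) * Orient.e o + ((h : ℝ) : ℂ) * Orient.ν o))
      (Icc (Orient.tngC o (R.boundary s) ⊓ Orient.tngC o (R.boundary s'))
        (Orient.tngC o (R.boundary s) ⊔ Orient.tngC o (R.boundary s')))) :
    Tendsto (fun δ => (∑ v ∈ rowTail R δ s \ rowTail R δ s', rowWeight R δ v) / N δ) (𝓝[>] 0)
      (𝓝 (∫ x in (Orient.tngC o (R.boundary s) ⊓ Orient.tngC o (R.boundary s'))..
        (Orient.tngC o (R.boundary s) ⊔ Orient.tngC o (R.boundary s')),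
        Φ (((x : ℝ) : ℂ) * Orient.e o + ((h : ℝ) : ℂ) * Orient.ν o))) := by
  set T : ℝ → ℝ := fun t => Orient.tngC o (R.boundary t) with hT
  set f : ℝ → ℝ := fun x => Φ (((x : ℝ) : ℂ) * Orient.e o + ((h : ℝ) : ℂ) * Orient.ν o) with hf
  set α : ℝ := T s ⊓ T s' with hα
  set β : ℝ := T s ⊔ T s' with hβ
  change Tendsto (fun δ => (∑ v ∈ rowTail R δ s \ rowTail R δ s', rowWeight R δ v) / N δ) (𝓝[>] 0)
    (𝓝 (∫ x in α..β, f x))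
  have hσσ' : σ ≤ σ' := hσs.le.trans (hss'.le.trans hs'σ'.le)
  have hsI : s ∈ Icc σ σ' := ⟨hσs.le, hss'.le.trans hs'σ'.le⟩
  have hs'I : s' ∈ Icc σ σ' := ⟨hσs.le.trans hss'.le, hs'σ'.le⟩
  have hTne : T s ≠ T s' := fun heq => hss'.ne (kwl_injOn_tng R h1 h3 hh hsI hs'I heq)
  have hαβ : α < β := by
    rcases lt_or_gt_of_ne hTne with hlt | hlt
    · rw [hα, hβ, inf_eq_left.2 hlt.le, sup_eq_right.2 hlt.le]; exact hlt
    · rw [hα, hβ, inf_eq_right.2 hlt.le, sup_eq_left.2 hlt.le]; exact hlt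
  -- window values lie in the chord
  have hmono := kwl_strictMonoOn_or_strictAntiOn_tng R h1 hσσ' h3 hh
  have hchord : ∀ u ∈ Icc s s', α ≤ T u ∧ T u ≤ β := by
    intro u hu
    have huI : u ∈ Icc σ σ' := ⟨hσs.le.trans hu.1, hu.2.trans hs'σ'.le⟩
    rcases hmono with hm | hm
    · have h1' : T s ≤ T u := hm.monotoneOn hsI huI hu.1
      have h2' : T u ≤ T s' := hm.monotoneOn huI hs'I hu.2
      exact ⟨inf_le_left.trans h1', h2'.trans le_sup_right⟩
    · have h1' : T u ≤ T s := hm.antitoneOn hsI huI hu.1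
      have h2' : T s' ≤ T u := hm.antitoneOn huI hs'I hu.2
      exact ⟨inf_le_right.trans h2', h1'.trans le_sup_left⟩
  obtain ⟨d₀, hd₀, hsep⟩ := kwl_exists_param_sep R h1 hσs hss'.le hs'σ' h3
  refine Metric.tendsto_nhds.2 fun ε hε => ?_
  -- Riemann sums with `ε/2`, point asymptotics with `ε₁`
  obtain ⟨δ₀, hδ₀, hRiem⟩ := kwl_riemann_sum hαβ.le hΦc (half_pos hε)
  have hL : 0 < β - α + 2 := by linarith
  set ε₁ : ℝ := ε / (4 * (β - α + 2)) with hε₁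
  have hε₁pos : 0 < ε₁ := by positivity
  have hsmall : ∀ᶠ δ in 𝓝[>] (0 : ℝ), 0 < δ ∧ δ < min (min δ₀ 1) (min (r / 4) (d₀ / 2)) :=
    Ioo_mem_nhdsGT (by positivity)
  filter_upwards [hN ε₁ hε₁pos, hsmall] with δ hNδ hδI
  obtain ⟨hδ, hδlt⟩ := hδI
  have hδδ₀ : δ < δ₀ := lt_of_lt_of_le hδlt ((min_le_left _ _).trans (min_le_left _ _))
  have hδ1 : δ < 1 := lt_of_lt_of_le hδlt ((min_le_left _ _).trans (min_le_right _ _))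
  have hδr : 4 * δ ≤ r := by
    have := lt_of_lt_of_le hδlt ((min_le_right _ _).trans (min_le_left _ _)); linarith
  have hδd : 2 * δ < d₀ := by
    have := lt_of_lt_of_le hδlt ((min_le_right _ _).trans (min_le_right _ _)); linarith
  set W : Finset (Site 2) := rowTail R δ s \ rowTail R δ s' with hW
  -- structure of `W`
  have hWv : ∀ v ∈ W, Orient.nrm o v = ⌈h / δ⌉ ∧ ∃ u ∈ Ico s s',
      R.boundary u = (((δ * (Orient.tng o v : ℝ) : ℝ)) : ℂ) * Orient.e o + ((h : ℝ) : ℂ) * Orient.ν o ∧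
      dist (meshPoint δ v) (R.boundary u) < δ :=
    fun v hv => kwl_sdiff_vertex R h1 hσs hss'.le hs'σ' h3 hcl hop hsep hδ hδr hδd hv
  -- the index set
  set K : Finset ℤ := W.image (Orient.tng o) with hK
  have hinjK : Set.InjOn (Orient.tng o) ↑W := fun v hv v' hv' heq =>
    kwl_eq_of_tng_eq_of_nrm_eq heq (by rw [(hWv v hv).1, (hWv v' hv').1])
  have hK1 : ∀ k ∈ K, α ≤ δ * k ∧ δ * k ≤ β := by
    intro k hk
    obtain ⟨v, hv, rfl⟩ := Finset.mem_image.1 hk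
    obtain ⟨-, u, hu, hux, -⟩ := hWv v hv
    have hTu : T u = δ * (Orient.tng o v : ℝ) := by
      show Orient.tngC o (R.boundary u) = _
      rw [hux, Orient.tngC_combo]
    rw [← hTu]
    exact hchord u ⟨hu.1, hu.2.le⟩
  have hK2 : ∀ k : ℤ, α < δ * k → δ * k < β → k ∈ K := by
    intro k hk1 hk2
    have hmem : (δ * k : ℝ) ∈ uIcc (T s) (T s') := ⟨hk1.le, hk2.le⟩
    obtain ⟨u, hu, hTu, hbu⟩ := kwl_exists_param_of_mem_uIcc R hss'.le
      (fun t ht => hh t ⟨hσs.le.trans ht.1, ht.2.trans hs'σ'.le⟩) hmem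
    have hus' : u ≠ s' := by
      intro heq
      have hTs' : T s' = δ * k := by rw [← heq]; exact hTu
      rcases le_total (T s) (T s') with hle | hle
      · rw [hβ, sup_eq_right.2 hle] at hk2; linarith
      · rw [hα, inf_eq_right.2 hle] at hk1; linarith
    set v : Site 2 := (Orient.frame o).symm ![k, ⌈h / δ⌉] with hv
    have hfv : Orient.frame o v = ![k, ⌈h / δ⌉] := by rw [hv, Equiv.apply_symm_apply]
    have htv : Orient.tng o v = k := by rw [← Orient.frame_apply_zero, hfv]; rfl
    have hnv : Orient.nrm o v = ⌈h / δ⌉ := by rw [← Orient.frame_apply_one, hfv]; rfl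
    have hvW : v ∈ W := kwl_mem_sdiff_of_foot R h1 hσs.le hs'σ'.le h3 hcl hop hδ (by linarith) hnv
      (u := u) ⟨hu.1, lt_of_le_of_ne hu.2 hus'⟩ (by rw [hbu, htv])
    exact Finset.mem_image.2 ⟨v, hvW, htv⟩
  have hRδ := hRiem δ hδ hδδ₀ K hK1 hK2
  -- the point asymptotics on `W`
  have hpt : ∀ v ∈ W, |rowWeight R δ v / (δ * N δ) - f (δ * (Orient.tng o v : ℝ))| ≤ ε₁ := by
    intro v hv
    obtain ⟨-, u, hu, hux, hdist⟩ := hWv v hv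
    have hvrow : v ∈ boundaryRow R δ := rowTail_subset R δ s (Finset.mem_sdiff.1 hv).1
    have := hNδ v hvrow u ⟨hσs.le.trans hu.1, hu.2.le.trans hs'σ'.le⟩ (by linarith)
    rwa [hux] at this
  -- the sums
  have hsumK : ∑ k ∈ K, δ * f (δ * k) = ∑ v ∈ W, δ * f (δ * (Orient.tng o v : ℝ)) := by
    rw [hK, Finset.sum_image hinjK]
  have hcardK : K.card = W.card := Finset.card_image_of_injOn hinjK
  have hcardW : (W.card : ℝ) * δ ≤ β - α + δ := by
    rw [← hcardK]; exact kwl_card_mul_le hδ hαβ.le hK1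
  have hS : (∑ v ∈ W, rowWeight R δ v) / N δ = ∑ v ∈ W, δ * (rowWeight R δ v / (δ * N δ)) := by
    rw [Finset.sum_div]
    refine Finset.sum_congr rfl fun v _ => ?_
    rw [mul_div_assoc', mul_div_mul_left _ _ hδ.ne']
  have hdiff : |(∑ v ∈ W, rowWeight R δ v) / N δ - ∑ v ∈ W, δ * f (δ * (Orient.tng o v : ℝ))| ≤
      (W.card : ℝ) * δ * ε₁ := by
    rw [hS, ← Finset.sum_sub_distrib]
    refine (Finset.abs_sum_le_sum_abs _ _).trans ?_
    have : ∀ v ∈ W, |δ * (rowWeight R δ v / (δ * N δ)) - δ * f (δ * (Orient.tng o v : ℝ))| ≤ δ * ε₁ := by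
      intro v hv
      rw [← mul_sub, abs_mul, abs_of_pos hδ]
      exact mul_le_mul_of_nonneg_left (hpt v hv) hδ.le
    refine (Finset.sum_le_sum this).trans ?_
    rw [Finset.sum_const, nsmul_eq_mul]
    linarith
  -- assemble
  rw [Real.dist_eq]
  have hε4 : (W.card : ℝ) * δ * ε₁ ≤ ε / 4 := by
    have hle1 : (W.card : ℝ) * δ ≤ β - α + 1 := by linarith
    calc (W.card : ℝ) * δ * ε₁ ≤ (β - α + 1) * ε₁ := by gcongr
      _ = (ε / 4) * ((β - α + 1) / (β - α + 2)) := by rw [hε₁]; field_simp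
      _ ≤ (ε / 4) * 1 := by
          gcongr
          rw [div_le_one hL]; linarith
      _ = ε / 4 := mul_one _
  calc |(∑ v ∈ W, rowWeight R δ v) / N δ - ∫ x in α..β, f x|
      ≤ |(∑ v ∈ W, rowWeight R δ v) / N δ - ∑ v ∈ W, δ * f (δ * (Orient.tng o v : ℝ))| +
          |∑ k ∈ K, δ * f (δ * k) - ∫ x in α..β, f x| := by
        rw [hsumK]; exact abs_sub_le _ _ _
    _ ≤ ε / 4 + ε / 2 := add_le_add (hdiff.trans hε4) hRδ
    _ < ε := by linarith

end Summit.CriticalPhenomena.CardyFormulaZ2.Cruxes.RectilinearCardy.ExcursionKernelCovariance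

end
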